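import Mathlib
import Literature.NumberTheory.LFunctions.Zhang2022.RepairGapTerminalWindows
import Literature.NumberTheory.LFunctions.Zhang2022.SkeletonMainOrderEndgame
import Literature.NumberTheory.LFunctions.Zhang2022.Section18XiJEvalC233
import Literature.NumberTheory.LFunctions.Zhang2022.Section4Prop22Eventually
import Literature.NumberTheory.LFunctions.Zhang2022.Section18Frakc2Readings
import Literature.NumberTheory.LFunctions.Zhang2022.KnifeEdgeEllVernierVacuity
import HarnessLib

/-!
# Zhang (2022), rescue tables (D-0124): the §2-endgame NODES at Zhang's own design are theorems or
# restatements of «¬(A) eventually» — the tribunal desk certificate as tree lemmas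

Topic `Literature/NumberTheory/LFunctions/Zhang2022` (Landau–Siegel audit tree; verdict-neutral).
Y. Zhang, *Discrete mean estimates and the Landau–Siegel zero*, arXiv:2211.02515v1 (2022)
[Zhang2022LandauSiegel] — **an unrefereed manuscript under adjudication; nothing in this file asserts or
denies its Theorems 1–2, and nothing here is a claim about Landau–Siegel zeros. The programme SEARCHES and
TYPES; no claim about Landau–Siegel zeros, Theorems 1–2 of arXiv:2211.02515 or a repaired Margin232 until a
kernel theorem says so.**

Source: the LS-desk certificate `tribunal-frontier/tools-ls-desk/probes/RepairNodeJunk.lean` (sha16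
d445e4405e123c49, namespace `T1ProbeLS.RepairNodes`, 0 sorry), which the rescue tables (REPAIR-CATALOGUE rows
LSR-033/034/035, BED §0.2 / node group 2, GAP-TABLE Part A) cite by sha; restated here as tree lemmas so that
those cells can cite declarations, in the style of `KnifeEdgeEllVernierVacuity.lean` (theorems only; «¬(A)
eventually» is spelled `ForAllLarge fun D _ χ => ¬ AssumptionA D χ`, no named `Prop` is introduced).

Content, all for «every sufficiently large `c′`» (the tree's `Skeleton.sec2_inputs_hold` /
`Section4.prop22_eventually` thresholds) and all about ZHANG'S OWN SUMS at the design θ₀ (`xi1`, `xiJ`,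
`xiStar1`, `xi11`, `xi12`):

* RN0 VACUITY: «¬(A) eventually» implies every (A)-guarded node at EVERY constant
  (the five family instances, via the tree's `KnifeEdgeEll.Vernier.forAllLarge_guarded_of_notA`); the incompatibility principle
  `notAEventually_of_incompatible`.
* RN4 the two generic lemmas: `notAEventually_of_two_mainTerms` (two (A)-conditional two-sided evaluations
  of the same sum with different constants force «¬(A) eventually», because `𝔞 ≥ a₀ > 0` under (A),
  `Skeleton.frakALowerBound_holds`, and `𝔓 > 0` eventually, `Skeleton.frakP_eventually_pos`), its real twin,
  and `notAEventually_of_node_lt_eval` (a one-sided node asserted BELOW a two-sided evaluation of the tree).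
* RN3 MAIN-TERM RE-EVALUATIONS are restatements: `Repair.Gap.Eval1017With c′ d` with `d ≠ 𝔡′+𝔡`,
  `Repair.Gap.Eval823With c′ k` with `k ≠ Re 𝔠₁`, `Skeleton.Eval97With c′ k` with `k ≠ Re 𝔠₂ᶜ` — each
  «for all large `c′`» `↔` «¬(A) eventually»; in particular the PRINTED (9.7) `Skeleton.Eval97 c′`
  (constant `Re 𝔠₂` of the printed-prefactor reading; `Re 𝔠₂ ≠ Re 𝔠₂ᶜ` is the tree's `frakc2_re_ne_frakc2c_re`, Section18Frakc2Readings) is such a restatement,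
  while the c-reading `Eval97With c′ (Re 𝔠₂ᶜ)` is the tree's theorem (`Repair.Gap.eval97With_have`).
* RN2 the (2.33)-NODE `Skeleton.Ineq233With c′ c_J`: THEOREM for `c_J ≥ C₂₃₃` (tree:
  `Repair.Gap.ineq233With_of_ge`), restatement of «¬(A) eventually» for `c_J < C₂₃₃`
  (`ineq233With_iff_notAEventually_of_lt`); numerals `2546.8476 / 2546.8478`, NO window; the printed node
  `Skeleton.Ineq233 c′` (`Ξ_J < 3000𝔞𝔓`) is a theorem (`ineq233_printed_eventually`).
* RN1 the (2.32)-NODE `Skeleton.Ineq232With c′ q`: THEOREM for `q ≥ c₂₃₂ᴱ` (tree: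
  `Repair.Gap.ineq232With_of_ge`), restatement for `q < c₂₃₂ᴱ − 4·10⁻⁵` (`ineq232With_iff_notAEventually_of_lt`,
  from the lower evaluation `xi1_lower_eventually` = (8.2) + the three two-sided evaluations the tree proves;
  the `4·10⁻⁵` is twice the rounding slack of (18.1)); numerals `0.0553 / 0.055363`; the PRINTED (2.32)
  (`q = 0.001`) is a restatement (`ineq232_printed_iff_notAEventually`).
* RN5 ENDGAME COROLLARIES: one large `c′` with (2.32) at a CLOSING constant `q` (resp. (2.33) at a closing
  `c_J`) gives «¬(A) eventually» through the tree's endgame `Skeleton.eventually_not_assumptionA_mainOrder`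
  (`notAEventually_of_ineq232With_closing`, `notAEventually_of_ineq233With_closing`); the closing thresholds
  themselves are `Repair.Gap.mainOrderContradiction_C233_of_le` / `…_c232E_of_le` (RepairGapTerminalWindows).

Reading (desk T1, verbatim): at θ₀ every node-crux is junk (theorem or restatement); a REPAIR must change the
DESIGN (new sums), and then the per-crux restatement test is «are the complementary inputs at the same design
already tree theorems?». Deliberately NOT here: any new definition (the families `Eval823With` / `Eval1017With`
are `RepairGapCurrencies`', `Eval97With` / `Ineq232With` / `Ineq233With` the skeleton's); any statement about
Theorems 1–2; the HAVE-side theorems and the terminal windows already in `RepairGapCurrencies` /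
`RepairGapTerminalWindows` (imported, not restated).

## References

* Y. Zhang, arXiv:2211.02515v1 (2022), §2 (2.32)–(2.33) p. 6, §8 (8.2), (8.23)–(8.24), §9 (9.7)–(9.8),
  §10 (10.17), §18 (18.1)–(18.3). [cite: Zhang2022LandauSiegel, §§2, 8, 9, 10, 18]
-/

noncomputable section

open Complex Real

namespace Literature.NumberTheory.LFunctions.Zhang2022.Repair.Nodes

open Skeleton Repair.Gap

/-! ## RN0 — vacuity: «¬(A) eventually» gives every (A)-guarded node at every constant -/

/-- **Incompatibility principle.** Two (A)-conditional eventual statements whose conclusions cannot hold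
together (eventually) force «¬(A) eventually». [cite: Zhang2022LandauSiegel, §2 p. 6] -/
theorem notAEventually_of_incompatible {P Q : (D : ℕ) → [NeZero D] → DirichletCharacter ℂ D → Prop}
    (hP : ForAllLarge fun D _ χ => AssumptionA D χ → P D χ)
    (hQ : ForAllLarge fun D _ χ => AssumptionA D χ → Q D χ)
    (hPQ : ForAllLarge fun D _ χ => P D χ → Q D χ → False) :
    ForAllLarge fun D _ χ => ¬ AssumptionA D χ :=
  ((hP.and hQ).and hPQ).mono fun _ _ _ _ _ h hA => h.2 (h.1.1 hA) (h.1.2 hA)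

/-- RN0 for the (2.32)-family: «¬(A) eventually» gives `Ineq232With c′ q` at EVERY `q`.
[cite: Zhang2022LandauSiegel, §2 (2.32)] -/
theorem ineq232With_of_notAEventually (c' q : ℝ) (h : ForAllLarge fun D _ χ => ¬ AssumptionA D χ) :
    Ineq232With c' q :=
  fun _ _ => KnifeEdgeEll.Vernier.forAllLarge_guarded_of_notA h

/-- RN0 for the (2.33)-family: «¬(A) eventually» gives `Ineq233With c′ c_J` at EVERY `c_J`.
[cite: Zhang2022LandauSiegel, §2 (2.33)] -/
theorem ineq233With_of_notAEventually (c' cJ : ℝ) (h : ForAllLarge fun D _ χ => ¬ AssumptionA D χ) :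
    Ineq233With c' cJ :=
  fun _ _ => KnifeEdgeEll.Vernier.forAllLarge_guarded_of_notA h

/-- RN0 for the (10.17)-family: «¬(A) eventually» gives `Eval1017With c′ d` at EVERY `d`.
[cite: Zhang2022LandauSiegel, §10 (10.17)] -/
theorem eval1017With_of_notAEventually (c' : ℝ) (d : ℂ) (h : ForAllLarge fun D _ χ => ¬ AssumptionA D χ) :
    Eval1017With c' d :=
  fun _ _ => KnifeEdgeEll.Vernier.forAllLarge_guarded_of_notA h

/-- RN0 for the (8.23)-family: «¬(A) eventually» gives `Eval823With c′ k` at EVERY `k`.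
[cite: Zhang2022LandauSiegel, §8 (8.23)] -/
theorem eval823With_of_notAEventually (c' k : ℝ) (h : ForAllLarge fun D _ χ => ¬ AssumptionA D χ) :
    Eval823With c' k :=
  fun _ _ => KnifeEdgeEll.Vernier.forAllLarge_guarded_of_notA h

/-- RN0 for the (9.7)-family: «¬(A) eventually» gives `Eval97With c′ k` at EVERY `k`.
[cite: Zhang2022LandauSiegel, §9 (9.7)] -/
theorem eval97With_of_notAEventually (c' k : ℝ) (h : ForAllLarge fun D _ χ => ¬ AssumptionA D χ) :
    Eval97With c' k :=
  fun _ _ => KnifeEdgeEll.Vernier.forAllLarge_guarded_of_notA h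

/-! ## RN4 — the two generic lemmas -/

/-- **Two main terms.** Two eventual (A)-conditional evaluations `‖X − d₁𝔞𝔓‖ ≤ ε𝔓`, `‖X − d₂𝔞𝔓‖ ≤ ε𝔓`
(every `ε > 0`) of the SAME quantity with `d₁ ≠ d₂` force «¬(A) eventually» — because `𝔞 ≥ a₀ > 0` under (A)
(`frakALowerBound_holds`, Lemma 5.7) and `𝔓 > 0` eventually (`frakP_eventually_pos`).
[cite: Zhang2022LandauSiegel, §2 p. 6; §5 Lemma 5.7] -/
theorem notAEventually_of_two_mainTerms {X : (D : ℕ) → [NeZero D] → DirichletCharacter ℂ D → ℂ} {d₁ d₂ : ℂ}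
    (hne : d₁ ≠ d₂)
    (h₁ : ∀ ε : ℝ, 0 < ε → ForAllLarge fun D _ χ => AssumptionA D χ →
      ‖X D χ - d₁ * frakA χ * frakP D‖ ≤ ε * frakP D)
    (h₂ : ∀ ε : ℝ, 0 < ε → ForAllLarge fun D _ χ => AssumptionA D χ →
      ‖X D χ - d₂ * frakA χ * frakP D‖ ≤ ε * frakP D) :
    ForAllLarge fun D _ χ => ¬ AssumptionA D χ := by
  obtain ⟨a₀, ha₀, ha⟩ := frakALowerBound_holds
  obtain ⟨D₁, hP⟩ := frakP_eventually_pos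
  have hδ : 0 < ‖d₁ - d₂‖ := norm_pos_iff.2 (sub_ne_zero.2 hne)
  set ε : ℝ := ‖d₁ - d₂‖ * a₀ / 4 with hε
  have hε0 : 0 < ε := by positivity
  obtain ⟨D₀, h⟩ := ((h₁ ε hε0).and (h₂ ε hε0)).and ha
  refine ⟨max D₀ D₁, fun D _ χ hD hq hp hA => ?_⟩
  obtain ⟨⟨e₁, e₂⟩, ha'⟩ := h D χ (le_trans (le_max_left _ _) hD) hq hp
  have hPpos : 0 < frakP D := hP D (le_trans (le_max_right _ _) hD)
  have haa : a₀ ≤ frakA χ := ha' hA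
  have hA0 : 0 ≤ frakA χ := le_trans ha₀.le haa
  have tri : ‖((d₁ : ℂ) * frakA χ * frakP D) - d₂ * frakA χ * frakP D‖ ≤ ε * frakP D + ε * frakP D :=
    calc ‖((d₁ : ℂ) * frakA χ * frakP D) - d₂ * frakA χ * frakP D‖
        = ‖(X D χ - d₂ * frakA χ * frakP D) - (X D χ - d₁ * frakA χ * frakP D)‖ := by
          congr 1; ring
      _ ≤ ‖X D χ - d₂ * frakA χ * frakP D‖ + ‖X D χ - d₁ * frakA χ * frakP D‖ := norm_sub_le _ _
      _ ≤ ε * frakP D + ε * frakP D := add_le_add (e₂ hA) (e₁ hA)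
  have hnorm : ‖((d₁ : ℂ) * frakA χ * frakP D) - d₂ * frakA χ * frakP D‖ =
      ‖d₁ - d₂‖ * frakA χ * frakP D := by
    rw [show ((d₁ : ℂ) * frakA χ * frakP D) - d₂ * frakA χ * frakP D =
        (d₁ - d₂) * (frakA χ : ℂ) * (frakP D : ℂ) by ring, norm_mul, norm_mul,
      Complex.norm_of_nonneg hA0, Complex.norm_of_nonneg hPpos.le]
  rw [hnorm] at tri
  have hlow : ‖d₁ - d₂‖ * a₀ * frakP D ≤ ‖d₁ - d₂‖ * frakA χ * frakP D :=
    mul_le_mul_of_nonneg_right (mul_le_mul_of_nonneg_left haa hδ.le) hPpos.le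
  have h4 : ‖d₁ - d₂‖ * a₀ = 4 * ε := by rw [hε]; ring
  rw [h4] at hlow
  nlinarith [mul_pos hε0 hPpos]

/-- Real-valued twin of `notAEventually_of_two_mainTerms` (`|·|` evaluations, real constants `k₁ ≠ k₂`).
[cite: Zhang2022LandauSiegel, §2 p. 6; §5 Lemma 5.7] -/
theorem notAEventually_of_two_mainTerms_real {X : (D : ℕ) → [NeZero D] → DirichletCharacter ℂ D → ℝ}
    {k₁ k₂ : ℝ} (hne : k₁ ≠ k₂)
    (h₁ : ∀ ε : ℝ, 0 < ε → ForAllLarge fun D _ χ => AssumptionA D χ →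
      |X D χ - k₁ * frakA χ * frakP D| ≤ ε * frakP D)
    (h₂ : ∀ ε : ℝ, 0 < ε → ForAllLarge fun D _ χ => AssumptionA D χ →
      |X D χ - k₂ * frakA χ * frakP D| ≤ ε * frakP D) :
    ForAllLarge fun D _ χ => ¬ AssumptionA D χ := by
  refine notAEventually_of_two_mainTerms (X := fun D _ χ => (X D χ : ℂ)) (d₁ := (k₁ : ℂ)) (d₂ := (k₂ : ℂ))
    (fun h => hne (by exact_mod_cast h))
    (fun ε hε => (h₁ ε hε).mono fun D _ χ _ _ h hA => ?_)
    (fun ε hε => (h₂ ε hε).mono fun D _ χ _ _ h hA => ?_)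
  all_goals
    have e := h hA
    rw [← Real.norm_eq_abs] at e
    simpa only [← Complex.ofReal_mul, ← Complex.ofReal_sub, Complex.norm_real] using e

/-- **One-sided node below a two-sided evaluation.** If under (A), eventually, `X ≥ (C − ε)𝔞𝔓 − ε𝔓` for
every `ε > 0` (a tree evaluation from below) while a node asserts `X ≤ (q + η)𝔞𝔓` for every `η > 0` with
`q < C`, then «¬(A) eventually». [cite: Zhang2022LandauSiegel, §2 p. 6; §5 Lemma 5.7] -/
theorem notAEventually_of_node_lt_eval {X : (D : ℕ) → [NeZero D] → DirichletCharacter ℂ D → ℝ} {C q : ℝ}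
    (hq : q < C)
    (hLow : ∀ ε : ℝ, 0 < ε → ForAllLarge fun D _ χ => AssumptionA D χ →
      (C - ε) * frakA χ * frakP D - ε * frakP D ≤ X D χ)
    (hNode : ∀ η : ℝ, 0 < η → ForAllLarge fun D _ χ => AssumptionA D χ →
      X D χ ≤ (q + η) * frakA χ * frakP D) :
    ForAllLarge fun D _ χ => ¬ AssumptionA D χ := by
  obtain ⟨a₀, ha₀, ha⟩ := frakALowerBound_holds
  obtain ⟨D₁, hP⟩ := frakP_eventually_pos
  have hm : 0 < C - q := sub_pos.2 hq
  set ε : ℝ := min ((C - q) / 4) ((C - q) * a₀ / 4) with hε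
  have hε0 : 0 < ε := lt_min (by positivity) (by positivity)
  have hε1 : ε ≤ (C - q) / 4 := min_le_left _ _
  have hε2 : ε ≤ (C - q) * a₀ / 4 := min_le_right _ _
  have hη0 : 0 < (C - q) / 4 := by positivity
  obtain ⟨D₀, h⟩ := ((hLow ε hε0).and (hNode _ hη0)).and ha
  refine ⟨max D₀ D₁, fun D _ χ hD hq' hp hA => ?_⟩
  obtain ⟨⟨e₁, e₂⟩, ha'⟩ := h D χ (le_trans (le_max_left _ _) hD) hq' hp
  have hPpos : 0 < frakP D := hP D (le_trans (le_max_right _ _) hD)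
  have haa : a₀ ≤ frakA χ := ha' hA
  have l := e₁ hA
  have u := e₂ hA
  -- cancel `𝔓 > 0`: `((C − q) − ε − (C − q)/4)·𝔞 ≤ ε`
  have key : ((C - q) - ε - (C - q) / 4) * frakA χ - ε ≤ 0 := by
    by_contra hc
    push Not at hc
    nlinarith [mul_pos hc hPpos]
  nlinarith [mul_le_mul_of_nonneg_left haa hm.le, mul_pos hm ha₀]

/-! ## RN3 — main-term re-evaluations at another constant are restatements of «¬(A) eventually»

The tree proves, for every sufficiently large `c′` (`sec2_inputs_hold`), the two-sided evaluations
`Eval1017 c′` (Ξ₁* ∼ (𝔡′+𝔡)𝔞𝔓), `Eval823 c′` (Ξ₁₁ ∼ 𝔠₁𝔞𝔓), `Eval97With c′ (Re 𝔠₂ᶜ)` (Ξ₁₂ ∼ 𝔠₂ᶜ𝔞𝔓)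
(HAVE side: `Repair.Gap.eval1017With_have`, `eval823With_have`, `eval97With_have`). -/

/-- **(10.17) re-evaluated**: for `d ≠ 𝔡′ + 𝔡`, «`Eval1017With c′ d` for all large `c′`» `↔` «¬(A)
eventually». [cite: Zhang2022LandauSiegel, §10 (10.17)] -/
theorem eval1017With_iff_notAEventually {d : ℂ} (hd : d ≠ dprime + dfrak) :
    (∃ c₀ : ℝ, ∀ c' ≥ c₀, Eval1017With c' d) ↔ ForAllLarge fun D _ χ => ¬ AssumptionA D χ := by
  refine ⟨fun ⟨c₀, h⟩ => ?_, fun h => ⟨0, fun c' _ => eval1017With_of_notAEventually c' d h⟩⟩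
  obtain ⟨cS, hS⟩ := sec2_inputs_hold
  obtain ⟨-, -, h1017, -⟩ := hS (max c₀ cS) (le_max_right _ _)
  exact notAEventually_of_two_mainTerms (X := fun D _ χ => xiStar1 (max c₀ cS) χ) hd
    (h _ (le_max_left _ _)) h1017

/-- Pointwise-in-`c′` form of `eval1017With_iff_notAEventually`: there is a threshold `cS` such that for EACH
`c′ ≥ cS`, `Eval1017With c′ d ↔` «¬(A) eventually» (`d ≠ 𝔡′ + 𝔡`). [cite: Zhang2022LandauSiegel, §10 (10.17)] -/
theorem eval1017With_iff_notAEventually_at {d : ℂ} (hd : d ≠ dprime + dfrak) :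
    ∃ cS : ℝ, ∀ c' ≥ cS, (Eval1017With c' d ↔ ForAllLarge fun D _ χ => ¬ AssumptionA D χ) := by
  obtain ⟨cS, hS⟩ := sec2_inputs_hold
  refine ⟨cS, fun c' hc => ⟨fun h => ?_, eval1017With_of_notAEventually c' d⟩⟩
  obtain ⟨-, -, h1017, -⟩ := hS c' hc
  exact notAEventually_of_two_mainTerms (X := fun D _ χ => xiStar1 c' χ) hd h h1017

/-- **(8.23) re-evaluated**: for `k ≠ Re 𝔠₁`, «`Eval823With c′ k` for all large `c′`» `↔` «¬(A)
eventually». [cite: Zhang2022LandauSiegel, §8 (8.23)] -/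
theorem eval823With_iff_notAEventually {k : ℝ} (hk : k ≠ frakc1.re) :
    (∃ c₀ : ℝ, ∀ c' ≥ c₀, Eval823With c' k) ↔ ForAllLarge fun D _ χ => ¬ AssumptionA D χ := by
  refine ⟨fun ⟨c₀, h⟩ => ?_, fun h => ⟨0, fun c' _ => eval823With_of_notAEventually c' k h⟩⟩
  obtain ⟨cS, hS⟩ := sec2_inputs_hold
  obtain ⟨-, -, -, h823, -⟩ := hS (max c₀ cS) (le_max_right _ _)
  exact notAEventually_of_two_mainTerms_real (X := fun D _ χ => xi11 (max c₀ cS) χ) hk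
    (h _ (le_max_left _ _)) h823

/-- **(9.7) re-evaluated**: for `k ≠ Re 𝔠₂ᶜ` (the tree's c-reading constant, the one that is PROVED),
«`Eval97With c′ k` for all large `c′`» `↔` «¬(A) eventually». [cite: Zhang2022LandauSiegel, §9 (9.7)] -/
theorem eval97With_iff_notAEventually {k : ℝ} (hk : k ≠ frakc2c.re) :
    (∃ c₀ : ℝ, ∀ c' ≥ c₀, Eval97With c' k) ↔ ForAllLarge fun D _ χ => ¬ AssumptionA D χ := by
  refine ⟨fun ⟨c₀, h⟩ => ?_, fun h => ⟨0, fun c' _ => eval97With_of_notAEventually c' k h⟩⟩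
  obtain ⟨cS, hS⟩ := sec2_inputs_hold
  obtain ⟨-, -, -, -, h97, -⟩ := hS (max c₀ cS) (le_max_right _ _)
  exact notAEventually_of_two_mainTerms_real (X := fun D _ χ => xi12 (max c₀ cS) χ) hk
    (h _ (le_max_left _ _)) h97

/-- `Eval97With c′ (Re 𝔠₂)` is the skeleton's printed node `Eval97 c′`. [cite: Zhang2022LandauSiegel, §9 (9.7)] -/
theorem eval97With_frakc2_iff (c' : ℝ) : Eval97With c' frakc2.re ↔ Eval97 c' := Iff.rfl

/-- **The PRINTED (9.7)** (`Eval97 c′`, constant `Re 𝔠₂` of the printed-prefactor reading): «for all large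
`c′`» it is `↔` «¬(A) eventually» — the tree proves the c-reading `Eval97With c′ (Re 𝔠₂ᶜ)` and the two
constants differ. [cite: Zhang2022LandauSiegel, §9 (9.7)] -/
theorem eval97_printed_iff_notAEventually :
    (∃ c₀ : ℝ, ∀ c' ≥ c₀, Eval97 c') ↔ ForAllLarge fun D _ χ => ¬ AssumptionA D χ :=
  eval97With_iff_notAEventually Zhang2022.frakc2_re_ne_frakc2c_re

/-! ## RN2 — the (2.33) node at θ₀: theorem above `C₂₃₃` (`Repair.Gap.ineq233With_of_ge`), restatement
below, no window -/

/-- The two-sided evaluation `|Ξ_J − C₂₃₃𝔞𝔓| ≤ ε𝔓` for every large `c′` (tree: `xiJ_evalC233_of_prop22` +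
`Section4.prop22_eventually`). [cite: Zhang2022LandauSiegel, §18 (18.3); §2 (2.33)] -/
theorem xiJ_evalC233_eventually : ∃ cS : ℝ, ∀ c' ≥ cS, ∀ ε : ℝ, 0 < ε →
    ForAllLarge fun D _ χ => AssumptionA D χ → |xiJ c' χ - C233 * frakA χ * frakP D| ≤ ε * frakP D := by
  obtain ⟨c₀, hc₀, h22⟩ := prop22_eventually
  exact ⟨c₀, fun c' hc => xiJ_evalC233_of_prop22 (le_trans hc₀ hc) (h22 c' hc)⟩

/-- **(2.33) node, `c_J < C₂₃₃`: a RESTATEMENT of «¬(A) eventually»** for every large `c′` (desk T1(b)); the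
complementary case `c_J ≥ C₂₃₃` is the tree theorem `Repair.Gap.ineq233With_of_ge`.
[cite: Zhang2022LandauSiegel, §2 (2.33); §18 (18.3)] -/
theorem ineq233With_iff_notAEventually_of_lt {cJ : ℝ} (hcJ : cJ < C233) :
    ∃ cS : ℝ, ∀ c' ≥ cS, (Ineq233With c' cJ ↔ ForAllLarge fun D _ χ => ¬ AssumptionA D χ) := by
  obtain ⟨cS, hS⟩ := xiJ_evalC233_eventually
  refine ⟨cS, fun c' hc => ⟨fun h => ?_, ineq233With_of_notAEventually c' cJ⟩⟩
  refine notAEventually_of_node_lt_eval (X := fun D _ χ => xiJ c' χ) hcJ (fun ε hε => ?_) h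
  obtain ⟨a₀, ha₀, ha⟩ := frakALowerBound_holds
  obtain ⟨D₁, hP⟩ := frakP_eventually_pos
  obtain ⟨D₀, h0⟩ := (hS c' hc ε hε).and ha
  refine ⟨max D₀ D₁, fun D _ χ hD hq hp hA => ?_⟩
  obtain ⟨h1, h2⟩ := h0 D χ (le_trans (le_max_left _ _) hD) hq hp
  have hPpos : 0 < frakP D := hP D (le_trans (le_max_right _ _) hD)
  have hApos : 0 < frakA χ := lt_of_lt_of_le ha₀ (h2 hA)
  have e := (abs_le.mp (h1 hA)).1
  nlinarith [mul_pos hApos hPpos, mul_pos hε (mul_pos hApos hPpos)]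

/-- **(2.33) numerals**: every `c_J ≤ 2546.8476` restates «¬(A) eventually»; every `c_J ≥ 2546.8478` is a
theorem (`C₂₃₃ ∈ (2546.8476, 2546.8478)`, `C233_bounds`) — no undecided window at the displayed digits.
[cite: Zhang2022LandauSiegel, §2 (2.33); §18 (18.3)] -/
theorem ineq233With_dichotomy_numerals {cJ : ℝ} :
    (cJ ≤ 2546.8476 → ∃ cS : ℝ, ∀ c' ≥ cS,
        (Ineq233With c' cJ ↔ ForAllLarge fun D _ χ => ¬ AssumptionA D χ)) ∧
    (2546.8478 ≤ cJ → ∃ cS : ℝ, ∀ c' ≥ cS, Ineq233With c' cJ) :=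
  ⟨fun h => ineq233With_iff_notAEventually_of_lt (lt_of_le_of_lt h C233_bounds.1),
   fun h => ineq233With_of_ge (le_trans C233_bounds.2.le h)⟩

/-- **The PRINTED (2.33) node** `Ineq233 c′` (`Ξ_J < 3000𝔞𝔓`) is a THEOREM for every large `c′`
(`C₂₃₃ < 3000`, two-sided evaluation, `𝔞 ≥ a₀ > 0`). [cite: Zhang2022LandauSiegel, §2 (2.33)] -/
theorem ineq233_printed_eventually : ∃ cS : ℝ, ∀ c' ≥ cS, Skeleton.Ineq233 c' := by
  obtain ⟨cS, hS⟩ := xiJ_evalC233_eventually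
  refine ⟨cS, fun c' hc => ?_⟩
  obtain ⟨a₀, ha₀, ha⟩ := frakALowerBound_holds
  obtain ⟨D₁, hP⟩ := frakP_eventually_pos
  have hgap : (0 : ℝ) < 3000 - C233 := by linarith [C233_bounds.2]
  have hε : 0 < (3000 - C233) * a₀ / 2 := by positivity
  obtain ⟨D₀, h0⟩ := (hS c' hc _ hε).and ha
  refine ⟨max D₀ D₁, fun D _ χ hD hq hp hA => ?_⟩
  obtain ⟨h1, h2⟩ := h0 D χ (le_trans (le_max_left _ _) hD) hq hp
  have hPpos : 0 < frakP D := hP D (le_trans (le_max_right _ _) hD)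
  have haa : a₀ ≤ frakA χ := h2 hA
  have e := (abs_le.mp (h1 hA)).2
  nlinarith [mul_pos ha₀ hPpos, mul_le_mul_of_nonneg_right haa hPpos.le, mul_pos hgap hPpos]

/-! ## RN1 — the (2.32) node at θ₀: theorem above `c₂₃₂ᴱ` (`Repair.Gap.ineq232With_of_ge`), restatement
below `c₂₃₂ᴱ − 4·10⁻⁵` -/

/-- The (2.32)-side constant of record, `c₂₃₂ᴱ := Re 𝔠₁ + Re 𝔠₂ᶜ + 2(Re 𝔠₃ᴱ(e″_D) + 10⁻⁵) ∈
(0.055348, 0.055363)` (`c232E_e1ppD_tol_bounds`, stated for the skeleton's `c232E e1ppD (Re 𝔠₂ᶜ)`).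
[cite: Zhang2022LandauSiegel, §18 p. 36] -/
theorem c232E_record_bounds :
    (0.055348 : ℝ) < c232E e1ppD frakc2c.re ∧ c232E e1ppD frakc2c.re < 0.055363 := by
  rw [c232E_eq]; exact c232E_e1ppD_tol_bounds

/-- **Ξ₁ from below** (every large `c′`): under (A), eventually,
`Ξ₁ ≥ (c₂₃₂ᴱ − 4·10⁻⁵ − ε)𝔞𝔓 − ε𝔓` — from (8.2) `Ξ₁ = Ξ₁₁ + Ξ₁₂ + 2Re Ξ₁₃` (`xi1_eq_of`) and the three
two-sided evaluations (8.23), (9.7)ᶜ, (18.1)ᴱ the tree proves (`sec2_inputs_hold`); the `4·10⁻⁵` is twice the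
two-sided rounding slack `10⁻⁵𝔞𝔓` of (18.1). [cite: Zhang2022LandauSiegel, §8 (8.2); §18 (18.1)] -/
theorem xi1_lower_eventually : ∃ cS : ℝ, ∀ c' ≥ cS, ∀ ε : ℝ, 0 < ε →
    ForAllLarge fun D _ χ => AssumptionA D χ →
      (c232E e1ppD frakc2c.re - 4e-5 - ε) * frakA χ * frakP D - ε * frakP D ≤ xi1 c' χ := by
  obtain ⟨cS, hS⟩ := sec2_inputs_hold
  refine ⟨cS, fun c' hc ε hε => ?_⟩
  obtain ⟨h22, h23, -, h823, h97, h181, -⟩ := hS c' hc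
  obtain ⟨a₀, ha₀, ha⟩ := frakALowerBound_holds
  obtain ⟨D₁, hP⟩ := frakP_eventually_pos
  have hε4 : 0 < ε / 4 := by positivity
  obtain ⟨D₀, h⟩ := ((((h22.and h23).and (h823 _ hε4)).and (h97 _ hε4)).and (h181 _ hε4)).and ha
  refine ⟨max (max D₀ D₁) 3, fun D _ χ hD hq hp hA => ?_⟩
  have hD3 : 3 ≤ D := le_trans (le_max_right _ _) hD
  have hD₀ : D₀ ≤ D := le_trans (le_trans (le_max_left _ _) (le_max_left _ _)) hD
  have hD₁ : D₁ ≤ D := le_trans (le_trans (le_max_right _ _) (le_max_left _ _)) hD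
  obtain ⟨⟨⟨⟨⟨h22', h23'⟩, h823'⟩, h97'⟩, h181'⟩, ha'⟩ := h D χ hD₀ hq hp
  have hPpos : 0 < frakP D := hP D hD₁
  have haa : a₀ ≤ frakA χ := ha' hA
  have hApos : 0 < frakA χ := lt_of_lt_of_le ha₀ haa
  have e1 := (abs_le.mp (h823' hA)).1
  have e2 := (abs_le.mp (h97' hA)).1
  have e3 : -(1e-5 * frakA χ * frakP D + ε / 4 * (frakA χ + 1) * frakP D) ≤
      (xi13 c' χ).re - (frakc3E e1ppD).re * frakA χ * frakP D := by
    have h3 := h181' hA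
    have hre : (xi13 c' χ - frakc3E e1ppD * frakA χ * frakP D).re =
        (xi13 c' χ).re - (frakc3E e1ppD).re * frakA χ * frakP D := by
      simp [Complex.sub_re, Complex.mul_re]
    have := (abs_le.mp (le_trans (Complex.abs_re_le_norm _) h3)).1
    rwa [hre] at this
  rw [xi1_eq_of χ hD3 h23' h22' (fun x => psiChiPrimitive_holds D χ x hD3 hp), c232E_eq]
  nlinarith [mul_pos hApos hPpos, mul_pos hε hPpos, mul_pos hε (mul_pos hApos hPpos)]

/-- **(2.32) node, `q < c₂₃₂ᴱ − 4·10⁻⁵`: a RESTATEMENT of «¬(A) eventually»** for every large `c′` (desk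
T1(b)); the complementary case `q ≥ c₂₃₂ᴱ` is the tree theorem `Repair.Gap.ineq232With_of_ge`.
[cite: Zhang2022LandauSiegel, §2 (2.32); §18] -/
theorem ineq232With_iff_notAEventually_of_lt {q : ℝ} (hq : q < c232E e1ppD frakc2c.re - 4e-5) :
    ∃ cS : ℝ, ∀ c' ≥ cS, (Ineq232With c' q ↔ ForAllLarge fun D _ χ => ¬ AssumptionA D χ) := by
  obtain ⟨cS, hS⟩ := xi1_lower_eventually
  exact ⟨cS, fun c' hc =>
    ⟨fun h => notAEventually_of_node_lt_eval (X := fun D _ χ => xi1 c' χ) hq (hS c' hc) h,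
      ineq232With_of_notAEventually c' q⟩⟩

/-- **(2.32) numerals**: every `q ≤ 0.0553` restates «¬(A) eventually»; every `q ≥ 0.055363` is a theorem;
the undecided window `(c₂₃₂ᴱ − 4·10⁻⁵, c₂₃₂ᴱ) ⊂ (0.055308, 0.055363)` is the rounding slack of (18.1) only.
[cite: Zhang2022LandauSiegel, §2 (2.32); §18] -/
theorem ineq232With_dichotomy_numerals {q : ℝ} :
    (q ≤ 0.0553 → ∃ cS : ℝ, ∀ c' ≥ cS,
        (Ineq232With c' q ↔ ForAllLarge fun D _ χ => ¬ AssumptionA D χ)) ∧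
    (0.055363 ≤ q → ∃ cS : ℝ, ∀ c' ≥ cS, Ineq232With c' q) :=
  ⟨fun h => ineq232With_iff_notAEventually_of_lt (by linarith [c232E_record_bounds.1]),
   fun h => ineq232With_of_ge (le_trans c232E_record_bounds.2.le h)⟩

/-- **The PRINTED (2.32) node** `Ineq232 c′` (`Ξ₁ < 0.001𝔞𝔓`): for every large `c′` it is `↔` «¬(A)
eventually» (`0.001 < c₂₃₂ᴱ − 4·10⁻⁵`). [cite: Zhang2022LandauSiegel, §2 (2.32)] -/
theorem ineq232_printed_iff_notAEventually :
    ∃ cS : ℝ, ∀ c' ≥ cS, (Skeleton.Ineq232 c' ↔ ForAllLarge fun D _ χ => ¬ AssumptionA D χ) := by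
  obtain ⟨cS, hS⟩ := ineq232With_iff_notAEventually_of_lt (q := 0.001) (by linarith [c232E_record_bounds.1])
  refine ⟨cS, fun c' hc => ⟨fun h => (hS c' hc).1 (fun η hη => ?_),
    fun h => KnifeEdgeEll.Vernier.forAllLarge_guarded_of_notA h⟩⟩
  obtain ⟨a₀, ha₀, ha⟩ := frakALowerBound_holds
  obtain ⟨D₁, hP⟩ := frakP_eventually_pos
  obtain ⟨D₀, h0⟩ := h.and ha
  refine ⟨max D₀ D₁, fun D _ χ hD hq hp hA => ?_⟩
  obtain ⟨h1, h2⟩ := h0 D χ (le_trans (le_max_left _ _) hD) hq hp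
  have hPpos : 0 < frakP D := hP D (le_trans (le_max_right _ _) hD)
  have hApos : 0 < frakA χ := lt_of_lt_of_le ha₀ (h2 hA)
  have := h1 hA
  nlinarith [mul_pos hη (mul_pos hApos hPpos)]

/-! ## RN5 — endgame corollaries (the closing thresholds are `Repair.Gap.mainOrderContradiction_C233_of_le`
/ `Repair.Gap.mainOrderContradiction_c232E_of_le`) -/

/-- **Endgame corollary, (2.32)-side**: one large `c′` with (2.32) at a constant `q` CLOSING against `C₂₃₃`
(`MainOrderContradiction q C233`, e.g. every `q ≤ 0.011025`) gives «¬(A) eventually» — every other §2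
input is a tree theorem and the endgame is `eventually_not_assumptionA_mainOrder`. Subsumed by RN1
(`q < 0.011026 < 0.0553`), but independent of the (18.1) slack. [cite: Zhang2022LandauSiegel, §2 p. 6, (2.32)] -/
theorem notAEventually_of_ineq232With_closing {q : ℝ} (hM : MainOrderContradiction q C233)
    (h : ∃ c₀ : ℝ, ∀ c' ≥ c₀, Ineq232With c' q) : ForAllLarge fun D _ χ => ¬ AssumptionA D χ := by
  obtain ⟨c₀, h232⟩ := h
  obtain ⟨cS, hS⟩ := sec2_inputs_hold
  obtain ⟨h22, h23, h1017, -, h97, -, -, h233, h111⟩ := hS (max c₀ cS) (le_max_right _ _)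
  exact eventually_not_assumptionA_mainOrder h22 h23 psiChiPrimitive_holds h1017
    (h232 _ (le_max_left _ _)) h233
    (prop26_of_evals_with h22 h23 psiChiPrimitive_holds h111 h97 frakALowerBound_holds) hM
    frakALowerBound_holds

/-- **Endgame corollary, (2.33)-side**: one large `c′` with (2.33) at a constant `c_J` CLOSING against
`c₂₃₂ᴱ` (`MainOrderContradiction c₂₃₂ᴱ c_J`, e.g. every `c_J ≤ 507`) gives «¬(A) eventually». Subsumed
by RN2 (`507 < C₂₃₃`). [cite: Zhang2022LandauSiegel, §2 p. 6, (2.33)] -/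
theorem notAEventually_of_ineq233With_closing {cJ : ℝ}
    (hM : MainOrderContradiction (c232E e1ppD frakc2c.re) cJ)
    (h : ∃ c₀ : ℝ, ∀ c' ≥ c₀, Ineq233With c' cJ) : ForAllLarge fun D _ χ => ¬ AssumptionA D χ := by
  obtain ⟨c₀, h233⟩ := h
  obtain ⟨cS, hS⟩ := sec2_inputs_hold
  obtain ⟨h22, h23, h1017, -, h97, -, h232, -, h111⟩ := hS (max c₀ cS) (le_max_right _ _)
  exact eventually_not_assumptionA_mainOrder h22 h23 psiChiPrimitive_holds h1017 h232
    (h233 _ (le_max_left _ _))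
    (prop26_of_evals_with h22 h23 psiChiPrimitive_holds h111 h97 frakALowerBound_holds) hM
    frakALowerBound_holds

/-- **Numeral instances of the corollaries' closing hypotheses** (from `RepairGapTerminalWindows`):
`MainOrderContradiction 0.011025 C₂₃₃` and `MainOrderContradiction c₂₃₂ᴱ 507` — hypothetical constants a
factor `> 5.02` below the tree's `c₂₃₂ᴱ` / `C₂₃₃` (`Repair.Gap.deficit_factor_502`).
[cite: Zhang2022LandauSiegel, §2 (2.32)–(2.33)] -/
theorem closing_numerals :
    MainOrderContradiction 0.011025 C233 ∧ MainOrderContradiction (c232E e1ppD frakc2c.re) 507 :=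
  ⟨mainOrderContradiction_C233_of_le le_rfl, mainOrderContradiction_c232E_of_le le_rfl⟩

end Literature.NumberTheory.LFunctions.Zhang2022.Repair.Nodes
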